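import Literature.NumberTheory.Sieve.MaynardTao
import HarnessLib

/-!
# Maynard's change of variables `y_{r₁,…,r_k} ↔ λ_{d₁,…,d_k}` (Maynard 2015 §5, Lemma 5.1) and the choice of `y` (§6)

Topic `Literature/NumberTheory/Sieve`; companion of `MaynardTao.lean` / `MaynardSieve.lean`
(J. Maynard, *Small gaps between primes*, Ann. of Math. (2) 181 (2015), 383–413 = arXiv:1311.4600;
page numbers refer to the arXiv text). A first brick of the proof of Prop. 4.1 (the named facts
`maynard_S1_asymptotic`, `maynard_S2_asymptotic` of `MaynardSieve.lean`).

Maynard diagonalises `S₁` through the variables (Lemma 5.1, p. 9)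

  `y_{r₁,…,r_k} = (∏ᵢ μ(rᵢ) φ(rᵢ)) ∑_{d : rᵢ ∣ dᵢ ∀ i} λ_{d₁,…,d_k} / ∏ᵢ dᵢ`,

notes that "this change is invertible" with inverse
`λ_d = (∏ μ(dᵢ) dᵢ) ∑_{r : dᵢ ∣ rᵢ} y_r / ∏ φ(rᵢ)` (display (5.8) area, p. 9), and in §6 CHOOSES
`y_r = F(log r₁/log R, …, log r_k/log R)` for `r = ∏ rᵢ` squarefree and coprime to `W`, `y_r = 0`
otherwise (the display opening §6, p. 13). Accordingly Prop. 4.1 — and the tree's `maynardWeight`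
(`MaynardTao.lean`) — DEFINE `λ_d` by the inverse formula with this `y`. This file proves that the
two descriptions agree: computing `y` from `λ = maynardWeight k F R W` by Maynard's formula returns
`μ(∏ rᵢ)² · 1[(rᵢ, W) = 1 ∀ i] · F(log rᵢ/log R)` on the box `1 ≤ rᵢ ≤ ⌊R⌋` (`maynardY_eq`) and
`0` outside it (`maynardY_eq_zero_of_not_mem`). The proof is the finite Möbius inversion of the
paper: swap the sums, factor the inner sum over the coordinates
(`∑_{d : rᵢ ∣ dᵢ ∣ eᵢ} ∏ μ(dᵢ) = ∏ᵢ ∑_{rᵢ ∣ dᵢ ∣ eᵢ} μ(dᵢ)`), and use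
`∑_{d ∣ n, r ∣ d} μ(d) = μ(r) · [n = r]` for squarefree `n` (`sum_moebius_filter_dvd_of_squarefree`,
from Mathlib's `μ * ζ = 1`).

## References

* J. Maynard, *Small gaps between primes*, Ann. of Math. (2) 181 (2015), 383–413,
  doi:10.4007/annals.2015.181.1.7, arXiv:1311.4600 [MaynardAnnals2015]: Prop. 4.1 (definition of
  `λ_d`, p. 7), Lemma 5.1 and its proof (the variables `y`, their inversion, p. 9), §6 (the choice
  of `y`, p. 13).
-/

noncomputable section

open Finset ArithmeticFunction
open scoped BigOperators ArithmeticFunction.Moebius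

namespace Literature.NumberTheory.Sieve

/-- The box `1 ≤ rᵢ ≤ ⌊R⌋` (`i < k`) of the summation variables of `maynardWeight`, `maynardS1`,
`maynardS2` (the support conditions `∏ rᵢ ≤ R` of Maynard §5 live inside it). [folklore] -/
def maynardBox (k : ℕ) (R : ℝ) : Finset (Fin k → ℕ) :=
  Fintype.piFinset fun _ : Fin k => Finset.Icc 1 ⌊R⌋₊

/-- Maynard's variables `y_{r₁,…,r_k} = (∏ᵢ μ(rᵢ) φ(rᵢ)) ∑_{d : rᵢ ∣ dᵢ ∀ i} λ_d / ∏ᵢ dᵢ`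
(Maynard 2015, Lemma 5.1, p. 9), for `λ_d = maynardWeight k F R W d`, the `dᵢ` running over the box
`1 ≤ dᵢ ≤ ⌊R⌋` (outside which `λ_d = 0`). [cite: MaynardAnnals2015, Lemma 5.1] -/
def maynardY (k : ℕ) (F : (Fin k → ℝ) → ℝ) (R : ℝ) (W : ℕ) (r : Fin k → ℕ) : ℝ :=
  (∏ i, ((μ (r i) : ℤ) : ℝ) * (Nat.totient (r i) : ℝ)) *
    ∑ d ∈ (maynardBox k R).filter (fun d => ∀ i, r i ∣ d i),
      maynardWeight k F R W d / ∏ i, (d i : ℝ)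

/-- Membership in the box. [folklore] -/
theorem mem_maynardBox_iff {k : ℕ} {R : ℝ} {r : Fin k → ℕ} :
    r ∈ maynardBox k R ↔ ∀ i, 1 ≤ r i ∧ r i ≤ ⌊R⌋₊ := by
  simp [maynardBox, Fintype.mem_piFinset]

/-- The one-variable Möbius inversion behind Lemma 5.1: for squarefree `n`,
`∑_{d ∣ n, r ∣ d} μ(d) = μ(r) · [n = r]` (write `d = r e` with `e ∣ n/r`, `μ(re) = μ(r) μ(e)`, and
`∑_{e ∣ m} μ(e) = [m = 1]`, Mathlib's `moebius_mul_coe_zeta`). [folklore] -/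
theorem sum_moebius_filter_dvd_of_squarefree {n : ℕ} (r : ℕ) (hn : Squarefree n) :
    ∑ d ∈ n.divisors.filter (fun d => r ∣ d), (μ d : ℤ) = if n = r then (μ r : ℤ) else 0 := by
  have hn0 : n ≠ 0 := hn.ne_zero
  by_cases hr : r ∣ n
  · obtain ⟨m, rfl⟩ := hr
    have hr0 : r ≠ 0 := left_ne_zero_of_mul hn0
    have hm0 : m ≠ 0 := right_ne_zero_of_mul hn0
    have hcop : r.Coprime m := Nat.coprime_of_squarefree_mul hn
    have hset : (r * m).divisors.filter (fun d => r ∣ d) = m.divisors.image (fun e => r * e) := by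
      ext d
      simp only [Finset.mem_filter, Nat.mem_divisors, Finset.mem_image]
      constructor
      · rintro ⟨⟨hd, -⟩, ⟨e, rfl⟩⟩
        refine ⟨e, ⟨(Nat.mul_dvd_mul_iff_left (Nat.pos_of_ne_zero hr0)).mp hd, hm0⟩, rfl⟩
      · rintro ⟨e, ⟨he, -⟩, rfl⟩
        exact ⟨⟨Nat.mul_dvd_mul_left r he, mul_ne_zero hr0 hm0⟩, Dvd.intro e rfl⟩
    rw [hset, Finset.sum_image
      (fun e₁ _ e₂ _ h => Nat.eq_of_mul_eq_mul_left (Nat.pos_of_ne_zero hr0) h)]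
    have hmul : ∀ e ∈ m.divisors, (μ (r * e) : ℤ) = μ r * μ e := by
      intro e he
      have hre : r.Coprime e := hcop.coprime_dvd_right (Nat.dvd_of_mem_divisors he)
      exact isMultiplicative_moebius.map_mul_of_coprime hre
    rw [Finset.sum_congr rfl hmul, ← Finset.mul_sum]
    have hμ : ∑ e ∈ m.divisors, (μ e : ℤ) = if m = 1 then 1 else 0 := by
      have h := congrArg (fun f : ArithmeticFunction ℤ => f m) moebius_mul_coe_zeta
      simp only [coe_mul_zeta_apply, one_apply] at h
      exact h
    rw [hμ]
    by_cases hm1 : m = 1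
    · subst hm1; simp
    · rw [if_neg hm1, mul_zero, if_neg]
      intro h
      exact hm1 (by simpa [hr0] using h)
  · have hempty : n.divisors.filter (fun d => r ∣ d) = ∅ := by
      ext d
      simp only [Finset.mem_filter, Nat.mem_divisors, Finset.notMem_empty, iff_false, not_and]
      rintro ⟨hd, -⟩ hrd
      exact hr (hrd.trans hd)
    rw [hempty, Finset.sum_empty, if_neg]
    rintro rfl
    exact hr dvd_rfl

/-- `∑_{d ∣ n, r ∣ d} μ(d) = μ(r) · [n = r]` for squarefree `n`, in `ℝ`. [folklore] -/
theorem sum_moebius_filter_dvd_real {n : ℕ} (r : ℕ) (hn : Squarefree n) :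
    ∑ d ∈ n.divisors.filter (fun d => r ∣ d), ((μ d : ℤ) : ℝ) =
      if n = r then ((μ r : ℤ) : ℝ) else 0 := by
  have h := sum_moebius_filter_dvd_of_squarefree r hn
  have h' := congrArg (fun z : ℤ => (z : ℝ)) h
  simp only [Int.cast_sum] at h'
  rw [h']
  split_ifs <;> simp

/-- `λ_d / ∏ dᵢ = (∏ μ(dᵢ)) · ∑_{r : dᵢ ∣ rᵢ, (rᵢ,W)=1} μ(∏ rᵢ)²/∏ φ(rᵢ) · F(log rᵢ/log R)` for
`dᵢ ≠ 0` (the definition of `λ_d` in Prop. 4.1 divided by `∏ dᵢ`). [cite: MaynardAnnals2015, Prop. 4.1] -/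
theorem maynardWeight_div_prod {k : ℕ} (F : (Fin k → ℝ) → ℝ) (R : ℝ) (W : ℕ) {d : Fin k → ℕ}
    (hd : ∀ i, d i ≠ 0) :
    maynardWeight k F R W d / ∏ i, (d i : ℝ) =
      (∏ i, ((μ (d i) : ℤ) : ℝ)) *
        ∑ r ∈ (Fintype.piFinset fun _ : Fin k => Finset.Icc 1 ⌊R⌋₊).filter
            (fun r => ∀ i, d i ∣ r i ∧ Nat.Coprime (r i) W),
          ((μ (∏ i, r i) : ℤ) : ℝ) ^ 2 / (∏ i, (Nat.totient (r i) : ℝ)) *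
            (maynardSimplex k).indicator F (fun i => Real.log (r i) / Real.log R) := by
  have hprod : (∏ i, (d i : ℝ)) ≠ 0 :=
    Finset.prod_ne_zero_iff.mpr fun i _ => by exact_mod_cast hd i
  rw [maynardWeight, Finset.prod_mul_distrib, div_eq_iff hprod]
  ring

/-- The inner Möbius sum of the inversion factorises over the coordinates: for `e` in the box,
`∑_{d in the box : rᵢ ∣ dᵢ ∣ eᵢ ∀ i} ∏ μ(dᵢ) = ∏ᵢ ∑_{dᵢ ∣ eᵢ, rᵢ ∣ dᵢ} μ(dᵢ)` (Maynard 2015, proof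
of Lemma 5.1, the display inverting the change of variables). [cite: MaynardAnnals2015, proof of Lemma 5.1] -/
theorem sum_ite_dvd_dvd_eq_prod {k : ℕ} {R : ℝ} (r e : Fin k → ℕ) (he : e ∈ maynardBox k R) :
    ∑ d ∈ maynardBox k R,
        (if (∀ i, r i ∣ d i) ∧ (∀ i, d i ∣ e i) then ∏ i, ((μ (d i) : ℤ) : ℝ) else 0) =
      ∏ i, ∑ d ∈ (e i).divisors.filter (fun d => r i ∣ d), ((μ d : ℤ) : ℝ) := by
  rw [Finset.prod_univ_sum, ← Finset.sum_filter]
  have he' := mem_maynardBox_iff.mp he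
  apply Finset.sum_congr
  · ext d
    simp only [Finset.mem_filter, mem_maynardBox_iff, Fintype.mem_piFinset, Nat.mem_divisors]
    constructor
    · rintro ⟨-, hrd, hde⟩ i
      exact ⟨⟨hde i, by have := (he' i).1; omega⟩, hrd i⟩
    · intro h
      refine ⟨fun i => ⟨Nat.pos_of_dvd_of_pos (h i).1.1 (he' i).1, ?_⟩, fun i => (h i).2,
        fun i => (h i).1.1⟩
      exact (Nat.le_of_dvd (he' i).1 (h i).1.1).trans (he' i).2
  · intro d _
    rfl

/-- For `∏ eᵢ` squarefree, `∏ᵢ ∑_{dᵢ ∣ eᵢ, rᵢ ∣ dᵢ} μ(dᵢ) = [e = r] · ∏ μ(rᵢ)`. [cite: MaynardAnnals2015, proof of Lemma 5.1] -/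
theorem prod_sum_moebius_filter_eq {k : ℕ} (r e : Fin k → ℕ) (hsq : Squarefree (∏ i, e i)) :
    ∏ i, ∑ d ∈ (e i).divisors.filter (fun d => r i ∣ d), ((μ d : ℤ) : ℝ) =
      if e = r then ∏ i, ((μ (r i) : ℤ) : ℝ) else 0 := by
  have hsqi : ∀ i, Squarefree (e i) := fun i =>
    hsq.squarefree_of_dvd (Finset.dvd_prod_of_mem _ (Finset.mem_univ i))
  simp_rw [fun i => sum_moebius_filter_dvd_real (r i) (hsqi i)]
  by_cases h : e = r
  · subst h; simp
  · rw [if_neg h]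
    obtain ⟨i, hi⟩ : ∃ i, e i ≠ r i := by
      by_contra hall
      push Not at hall
      exact h (funext hall)
    exact Finset.prod_eq_zero (Finset.mem_univ i) (if_neg hi)

/-- **Maynard's `y` recovered from `λ = maynardWeight`** (Maynard 2015, Lemma 5.1 "This change
is invertible" and the choice of `y` opening §6, p. 13): for `r` in the box `1 ≤ rᵢ ≤ ⌊R⌋`,
`y_r = μ(∏ rᵢ)² · 1[(rᵢ, W) = 1 ∀ i] · F(log r₁/log R, …, log r_k/log R)` (with `F` cut off to
`R_k`, as in `maynardWeight`). [cite: MaynardAnnals2015, Lemma 5.1 and §6, choice of y (p. 13)] -/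
theorem maynardY_eq {k : ℕ} (F : (Fin k → ℝ) → ℝ) (R : ℝ) (W : ℕ) {r : Fin k → ℕ}
    (hr : r ∈ maynardBox k R) :
    maynardY k F R W r =
      if (∀ i, Nat.Coprime (r i) W) then
        ((μ (∏ i, r i) : ℤ) : ℝ) ^ 2 *
          (maynardSimplex k).indicator F (fun i => Real.log (r i) / Real.log R)
      else 0 := by
  have hr' := mem_maynardBox_iff.mp hr
  -- abbreviations
  set Box := maynardBox k R with hBox
  set c : (Fin k → ℕ) → ℝ := fun e => ((μ (∏ i, e i) : ℤ) : ℝ) ^ 2 / (∏ i, (Nat.totient (e i) : ℝ)) *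
    (maynardSimplex k).indicator F (fun i => Real.log (e i) / Real.log R) with hc
  -- Step A: rewrite λ_d / ∏ dᵢ
  have hA : ∀ d ∈ Box.filter (fun d => ∀ i, r i ∣ d i),
      maynardWeight k F R W d / ∏ i, (d i : ℝ) =
        (∏ i, ((μ (d i) : ℤ) : ℝ)) * ∑ e ∈ Box.filter (fun e => ∀ i, d i ∣ e i ∧ Nat.Coprime (e i) W), c e := by
    intro d hd
    have hd' := mem_maynardBox_iff.mp (Finset.mem_filter.mp hd).1
    exact maynardWeight_div_prod F R W fun i => by have := (hd' i).1; omega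
  unfold maynardY
  rw [Finset.sum_congr rfl hA]
  -- Step B: swap the sums (both sides equal a double sum of `g d e`)
  set g : (Fin k → ℕ) → (Fin k → ℕ) → ℝ := fun d e =>
    if (∀ i, r i ∣ d i) ∧ (∀ i, d i ∣ e i) ∧ (∀ i, Nat.Coprime (e i) W) then
      (∏ i, ((μ (d i) : ℤ) : ℝ)) * c e else 0 with hg
  have hB1 : ∑ d ∈ Box.filter (fun d => ∀ i, r i ∣ d i),
      (∏ i, ((μ (d i) : ℤ) : ℝ)) * ∑ e ∈ Box.filter (fun e => ∀ i, d i ∣ e i ∧ Nat.Coprime (e i) W), c e =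
      ∑ d ∈ Box, ∑ e ∈ Box, g d e := by
    rw [Finset.sum_filter]
    refine Finset.sum_congr rfl fun d _ => ?_
    by_cases h1 : ∀ i, r i ∣ d i
    · rw [if_pos h1, Finset.mul_sum, Finset.sum_filter]
      refine Finset.sum_congr rfl fun e _ => ?_
      by_cases h2 : ∀ i, d i ∣ e i ∧ Nat.Coprime (e i) W
      · have h2a : ∀ i, d i ∣ e i := fun i => (h2 i).1
        have h2b : ∀ i, Nat.Coprime (e i) W := fun i => (h2 i).2
        simp [hg, h1, h2]
      · have : ¬ ((∀ i, r i ∣ d i) ∧ (∀ i, d i ∣ e i) ∧ (∀ i, Nat.Coprime (e i) W)) :=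
          fun h => h2 fun i => ⟨h.2.1 i, h.2.2 i⟩
        simp [hg, h2, this]
    · rw [if_neg h1]
      refine (Finset.sum_eq_zero fun e _ => ?_).symm
      simp [hg, h1]
  have hB2 : ∑ e ∈ Box, (if (∀ i, Nat.Coprime (e i) W) then
        c e * ∑ d ∈ Box, (if (∀ i, r i ∣ d i) ∧ (∀ i, d i ∣ e i) then ∏ i, ((μ (d i) : ℤ) : ℝ) else 0)
        else 0) = ∑ e ∈ Box, ∑ d ∈ Box, g d e := by
    refine Finset.sum_congr rfl fun e _ => ?_
    by_cases h3 : ∀ i, Nat.Coprime (e i) W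
    · rw [if_pos h3, Finset.mul_sum]
      refine Finset.sum_congr rfl fun d _ => ?_
      by_cases h12 : (∀ i, r i ∣ d i) ∧ (∀ i, d i ∣ e i)
      · simp [hg, h12, h3, mul_comm]
      · have : ¬ ((∀ i, r i ∣ d i) ∧ (∀ i, d i ∣ e i) ∧ (∀ i, Nat.Coprime (e i) W)) :=
          fun h => h12 ⟨h.1, h.2.1⟩
        simp [hg, h12, this]
    · rw [if_neg h3]
      refine (Finset.sum_eq_zero fun d _ => ?_).symm
      simp [hg, h3]
  have hB : ∑ d ∈ Box.filter (fun d => ∀ i, r i ∣ d i),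
      (∏ i, ((μ (d i) : ℤ) : ℝ)) * ∑ e ∈ Box.filter (fun e => ∀ i, d i ∣ e i ∧ Nat.Coprime (e i) W), c e =
      ∑ e ∈ Box, if (∀ i, Nat.Coprime (e i) W) then
        c e * ∑ d ∈ Box, (if (∀ i, r i ∣ d i) ∧ (∀ i, d i ∣ e i) then ∏ i, ((μ (d i) : ℤ) : ℝ) else 0)
        else 0 := by
    rw [hB1, hB2, Finset.sum_comm]
  rw [hB]
  -- Step C/D: evaluate the inner sums and collapse to `e = r`
  have hCD : ∀ e ∈ Box, (if (∀ i, Nat.Coprime (e i) W) then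
        c e * ∑ d ∈ Box, (if (∀ i, r i ∣ d i) ∧ (∀ i, d i ∣ e i) then ∏ i, ((μ (d i) : ℤ) : ℝ) else 0)
        else 0) =
      if e = r then (if (∀ i, Nat.Coprime (r i) W) then c r * ∏ i, ((μ (r i) : ℤ) : ℝ) else 0) else 0 := by
    intro e he
    rw [sum_ite_dvd_dvd_eq_prod r e he]
    by_cases hsq : Squarefree (∏ i, e i)
    · rw [prod_sum_moebius_filter_eq r e hsq]
      by_cases h : e = r
      · subst h; simp
      · simp [h]
    · -- `c e = 0`
      have hce : c e = 0 := by
        simp only [hc, ArithmeticFunction.moebius_eq_zero_of_not_squarefree hsq, Int.cast_zero,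
          zero_pow two_ne_zero, zero_div, zero_mul]
      by_cases h : e = r
      · subst h
        simp [hce]
      · simp [hce, h]
  rw [Finset.sum_congr rfl hCD, Finset.sum_ite_eq' Box r, if_pos hr]
  -- Step F: the algebra at `e = r`
  split_ifs with hcop
  · simp only [hc]
    have hφ : (∏ i, (Nat.totient (r i) : ℝ)) ≠ 0 :=
      Finset.prod_ne_zero_iff.mpr fun i _ => by
        exact_mod_cast (Nat.totient_pos.mpr (hr' i).1).ne'
    have hrew : (∏ i, ((μ (r i) : ℤ) : ℝ) * (Nat.totient (r i) : ℝ)) *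
        (((μ (∏ i, r i) : ℤ) : ℝ) ^ 2 / (∏ i, (Nat.totient (r i) : ℝ)) *
          (maynardSimplex k).indicator F (fun i => Real.log (r i) / Real.log R) *
          ∏ i, ((μ (r i) : ℤ) : ℝ)) =
        (∏ i, ((μ (r i) : ℤ) : ℝ)) ^ 2 * (((μ (∏ i, r i) : ℤ) : ℝ) ^ 2 *
          (maynardSimplex k).indicator F (fun i => Real.log (r i) / Real.log R)) := by
      rw [Finset.prod_mul_distrib]
      field_simp
    rw [hrew]
    by_cases hsq : Squarefree (∏ i, r i)
    · have hsqi : ∀ i, Squarefree (r i) := fun i =>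
        hsq.squarefree_of_dvd (Finset.dvd_prod_of_mem _ (Finset.mem_univ i))
      have hμprod : (∏ i, ((μ (r i) : ℤ) : ℝ)) ^ 2 = 1 := by
        rw [← Finset.prod_pow]
        exact Finset.prod_eq_one fun i _ => by
          exact_mod_cast ArithmeticFunction.moebius_sq_eq_one_of_squarefree (hsqi i)
      rw [hμprod, one_mul]
    · simp [ArithmeticFunction.moebius_eq_zero_of_not_squarefree hsq]
  · simp

/-- Outside the box `y_r = 0`: no `d` in the box is a multiple of `r` (some `rᵢ = 0` or `rᵢ > ⌊R⌋`).
[cite: MaynardAnnals2015, Lemma 5.1] -/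
theorem maynardY_eq_zero_of_not_mem {k : ℕ} (F : (Fin k → ℝ) → ℝ) (R : ℝ) (W : ℕ)
    {r : Fin k → ℕ} (hr : r ∉ maynardBox k R) : maynardY k F R W r = 0 := by
  unfold maynardY
  have hempty : (maynardBox k R).filter (fun d => ∀ i, r i ∣ d i) = ∅ := by
    ext d
    simp only [Finset.mem_filter, Finset.notMem_empty, iff_false, not_and]
    intro hd hdiv
    apply hr
    rw [mem_maynardBox_iff] at hd ⊢
    intro i
    obtain ⟨h1, h2⟩ := hd i
    refine ⟨Nat.pos_of_ne_zero fun h0 => ?_, (Nat.le_of_dvd h1 (hdiv i)).trans h2⟩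
    have := hdiv i
    rw [h0, zero_dvd_iff] at this
    omega
  rw [hempty, Finset.sum_empty, mul_zero]

end Literature.NumberTheory.Sieve
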